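import Summits.Ventures.Crystal3D.Theorems.StickyWulffConstantCoaxialWallLawSeamTargetPiece
import Summits.Ventures.Crystal3D.Theorems.StickyWulffConstantCoaxialWallLawSeamClosedCoreCapTable
import HarnessLib

/-!
# PIECES IN THE PAYER WINDOW: `pieceOf Y z c S` (site lattice anchored at `c`, closure in `B̄(z, 3)`), and EVERY (A)-pair near the payer descends to a piece
# (crux `CoaxialWallLaw`, stmt-Ventures-19481; line `WallLedgerF`, skeleton 'CoaxialWallLawCertificates' v8.1, stub `stub_incoherentSeamSmall`; F-TAIL-g12 §7 step 4)

HONEST FRAMING. Venture `Summits/Ventures/Crystal3D` (cell `crystal3d-full`); structural lemmas for the multi-piece split of lane F's T5b.  '…SeamReaderPiece' /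
'…SeamTargetPiece' anchor the piece's WINDOW at the reader / target; for erosion control near the payer (`JunkCapBoundClosed`, radius `2` about the window centre)
the window must be the PAYER's.  This file decouples the two: `pieceOf Y z c S` = capping closure, inside the payer window `Y ∩ B̄(z,3)`, of the balls at module
positions of the placement `S` relative to the lattice origin `c`.  It is cap-closed (`isCapClosed_pieceOf`), so the table `JunkCapBoundClosed capTable₂` applies to
it, and the descent theorems hold verbatim because a pair ending within `1` of `z` has its reader, the reader's dozen and all reflected positions within `3` of `z`.
Nothing about the stubs is claimed; F-C1 not moved.
* `pieceOf`, `pieceOf_subset`, `isCapClosed_pieceOf`, `mem_pieceOf_of_module` (site clause), `mem_pieceOf_base`, `mem_pieceOf_of_slot_at`;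
* `hasTwoPayers_of_subset` (the two-payer clause descends to any sub-configuration, kissing number);
* `reflect_far_slot_mem_of_capClosed`, `reflect_slot_mem_of_capClosed` — reflected positions cap triangles of ANY cap-closed core containing the base point and its
  in-plane hexagon;
* **`isEndPairA_pieceOf_of_straight`**, **`isEndPairA_pieceOf_of_cross`**, **`exists_pieceOf_of_isEndPairA`** — every (A)-end pair `(b, q)` of `Y` with `b` within
  `1` of `z` is an (A)-end pair of `pieceOf Y z c S` for `(c, S)` = (reader, class frame) or (target, mirrored frame).
-/

noncomputable section

namespace Summit.Ventures.Crystal3D.Theorems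

namespace TailResidue

open Summit.Ventures.Crystal3D Finset NearIdentity
open scoped InnerProductSpace

/-! ### Pieces in the payer window -/

open scoped Classical in
/-- **PIECE in the payer window**: the capping closure, inside `Y ∩ B̄(z, 3)`, of the balls at MODULE positions of the placement `S` relative to the origin `c`. -/
def pieceOf (Y : Finset (EuclideanSpace ℝ (Fin 3))) (z c : EuclideanSpace ℝ (Fin 3)) (S : EuclideanSpace ℝ (Fin 3) ≃ₗᵢ[ℝ] EuclideanSpace ℝ (Fin 3)) :
    Finset (EuclideanSpace ℝ (Fin 3)) :=
  capClosure (Y.filter fun x => dist z x ≤ 3) ((Y.filter fun x => dist z x ≤ 3).filter fun x => S.symm (x - c) ∈ coaxialModule 1 (Real.sqrt (2 / 3)))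

open scoped Classical in
/-- A piece lies in the window. -/
theorem pieceOf_subset_window (Y : Finset (EuclideanSpace ℝ (Fin 3))) (z c : EuclideanSpace ℝ (Fin 3)) (S : EuclideanSpace ℝ (Fin 3) ≃ₗᵢ[ℝ] EuclideanSpace ℝ (Fin 3)) :
    pieceOf Y z c S ⊆ Y.filter fun x => dist z x ≤ 3 :=
  capClosure_subset (filter_subset _ _)

/-- A piece lies in the configuration. -/
theorem pieceOf_subset (Y : Finset (EuclideanSpace ℝ (Fin 3))) (z c : EuclideanSpace ℝ (Fin 3)) (S : EuclideanSpace ℝ (Fin 3) ≃ₗᵢ[ℝ] EuclideanSpace ℝ (Fin 3)) :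
    pieceOf Y z c S ⊆ Y :=
  (pieceOf_subset_window Y z c S).trans (filter_subset _ _)

open scoped Classical in
/-- **A piece is cap-closed in the payer window.** -/
theorem isCapClosed_pieceOf (Y : Finset (EuclideanSpace ℝ (Fin 3))) (z c : EuclideanSpace ℝ (Fin 3)) (S : EuclideanSpace ℝ (Fin 3) ≃ₗᵢ[ℝ] EuclideanSpace ℝ (Fin 3)) :
    IsCapClosed Y z (pieceOf Y z c S) :=
  ⟨fun _ hx => mem_filter.1 (pieceOf_subset_window Y z c S hx),
    fun _ hx hzx hcap => mem_capClosure_of_capsTriangleIn (filter_subset _ _) (mem_filter.2 ⟨hx, hzx⟩) hcap⟩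

open scoped Classical in
/-- **Site clause**: a window ball at a module position of the placement (relative to `c`) is in the piece. -/
theorem mem_pieceOf_of_module {Y : Finset (EuclideanSpace ℝ (Fin 3))} {z c : EuclideanSpace ℝ (Fin 3)} (S : EuclideanSpace ℝ (Fin 3) ≃ₗᵢ[ℝ] EuclideanSpace ℝ (Fin 3))
    {x : EuclideanSpace ℝ (Fin 3)} (hx : x ∈ Y) (hzx : dist z x ≤ 3) (hmod : S.symm (x - c) ∈ coaxialModule 1 (Real.sqrt (2 / 3))) : x ∈ pieceOf Y z c S :=
  subset_capClosure _ (mem_filter.2 ⟨mem_filter.2 ⟨hx, hzx⟩, hmod⟩)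

/-- The origin is in its piece. -/
theorem mem_pieceOf_base {Y : Finset (EuclideanSpace ℝ (Fin 3))} {z c : EuclideanSpace ℝ (Fin 3)} (S : EuclideanSpace ℝ (Fin 3) ≃ₗᵢ[ℝ] EuclideanSpace ℝ (Fin 3))
    (hc : c ∈ Y) (hzc : dist z c ≤ 3) : c ∈ pieceOf Y z c S :=
  mem_pieceOf_of_module S hc hzc (by rw [sub_self, map_zero]; exact ⟨0, 0, 0, 0, by simp⟩)

/-- A module base point plus a slot, in the window and occupied, is in the piece. -/
theorem mem_pieceOf_of_slot_at {Y : Finset (EuclideanSpace ℝ (Fin 3))} {z c : EuclideanSpace ℝ (Fin 3)} (S : EuclideanSpace ℝ (Fin 3) ≃ₗᵢ[ℝ] EuclideanSpace ℝ (Fin 3))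
    {p w : EuclideanSpace ℝ (Fin 3)} (hp : S.symm (p - c) ∈ coaxialModule 1 (Real.sqrt (2 / 3))) (hw : w ∈ fccSlots) (hx : p + S w ∈ Y) (hzx : dist z (p + S w) ≤ 3) :
    p + S w ∈ pieceOf Y z c S :=
  mem_pieceOf_of_module S hx hzx (by rw [show p + S w - c = (p - c) + S w by abel, map_add, LinearIsometryEquiv.symm_apply_apply]; exact add_mem_module hp (slot_mem_module hw))

/-! ### The two-payer clause descends -/

open scoped Classical in
/-- **The exported two-payer clause descends to any sub-configuration** (kissing number twelve). -/
theorem hasTwoPayers_of_subset {Y E : Finset (EuclideanSpace ℝ (Fin 3))} (hY : ∀ p ∈ Y, ∀ p' ∈ Y, p ≠ p' → 1 ≤ dist p p') (hEY : E ⊆ Y)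
    {b : EuclideanSpace ℝ (Fin 3)} (hpay : HasTwoPayers Y b) : HasTwoPayers E b := by
  have hdeg : ∀ y, (E.filter fun p => dist y p = 1).card ≤ (Y.filter fun p => dist y p = 1).card :=
    fun y => card_le_card (fun p hp => by rw [mem_filter] at hp ⊢; exact ⟨hEY hp.1, hp.2⟩)
  rcases hpay with hle | ⟨z₁, hz₁, z₂, hz₂, hne, hd₁, hd₂, hdeg₁, hdeg₂⟩
  · exact Or.inl ((hdeg b).trans hle)
  · have drop : ∀ {w}, w ∈ Y → w ∉ E → dist b w = 1 → (E.filter fun p => dist b p = 1).card ≤ 11 := by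
      intro w hw hwE hd
      have hwmem : w ∈ Y.filter fun p => dist b p = 1 := mem_filter.2 ⟨hw, hd⟩
      have hs : E.filter (fun p => dist b p = 1) ⊆ (Y.filter fun p => dist b p = 1).erase w := by
        intro p hp; rw [mem_filter] at hp
        exact mem_erase.2 ⟨fun h => hwE (h ▸ hp.1), mem_filter.2 ⟨hEY hp.1, hp.2⟩⟩
      have h12 := card_filter_dist_eq_one_le_twelve Y hY b
      have hc := card_le_card hs
      rw [card_erase_of_mem hwmem] at hc
      omega
    by_cases hE₁ : z₁ ∈ E
    · by_cases hE₂ : z₂ ∈ E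
      · exact Or.inr ⟨z₁, hE₁, z₂, hE₂, hne, hd₁, hd₂, (hdeg z₁).trans hdeg₁, (hdeg z₂).trans hdeg₂⟩
      · exact Or.inl (drop hz₂ hE₂ hd₂)
    · exact Or.inl (drop hz₁ hE₁ hd₁)

/-! ### Reflected positions cap triangles of any cap-closed core -/

/-- **A reflected far slot caps a core triangle** of ANY cap-closed core `D` containing the base point `p` (within `2` of the payer) and its in-plane hexagon. -/
theorem reflect_far_slot_mem_of_capClosed {X D : Finset (EuclideanSpace ℝ (Fin 3))} {z : EuclideanSpace ℝ (Fin 3)} (hD : IsCapClosed X z D)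
    {S : EuclideanSpace ℝ (Fin 3) ≃ₗᵢ[ℝ] EuclideanSpace ℝ (Fin 3)} {n p : EuclideanSpace ℝ (Fin 3)} (hpD : p ∈ D) (hzp : dist z p ≤ 2) (hn1 : ‖n‖ = 1)
    (hmenu : ∀ u ∈ fccSlots, ⟪S u, n⟫_ℝ = 0 ∨ ⟪S u, n⟫_ℝ = Real.sqrt (2 / 3) ∨ ⟪S u, n⟫_ℝ = -Real.sqrt (2 / 3))
    (hplaneD : ∀ u ∈ fccSlots, ⟪S u, n⟫_ℝ = 0 → p + S u ∈ D) {w : EuclideanSpace ℝ (Fin 3)} (hw : w ∈ fccSlots) (hpos : 0 < ⟪S w, n⟫_ℝ)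
    (hmem : p + (S w - (2 * ⟪S w, n⟫_ℝ) • n) ∈ X) : p + (S w - (2 * ⟪S w, n⟫_ℝ) • n) ∈ D := by
  classical
  obtain ⟨u₁, hu₁, u₂, hu₂, u₃, hu₃, hn₁, hn₂, hn₃, h12, h13, h23, -, huniq⟩ := exists_far_frame S hn1 hmenu
  obtain ⟨u', hu', u'', hu'', hn', hn'', hwu', hwu'', hu'u''⟩ : ∃ u' ∈ fccSlots, ∃ u'' ∈ fccSlots, ⟪S u', n⟫_ℝ = Real.sqrt (2 / 3) ∧
      ⟪S u'', n⟫_ℝ = Real.sqrt (2 / 3) ∧ ⟪w, u'⟫_ℝ = 1 / 2 ∧ ⟪w, u''⟫_ℝ = 1 / 2 ∧ ⟪u', u''⟫_ℝ = 1 / 2 := by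
    rcases huniq w hw hpos with rfl | rfl | rfl
    · exact ⟨u₂, hu₂, u₃, hu₃, hn₂, hn₃, h12, h13, h23⟩
    · exact ⟨u₁, hu₁, u₃, hu₃, hn₁, hn₃, by rw [real_inner_comm]; exact h12, h23, h13⟩
    · exact ⟨u₁, hu₁, u₂, hu₂, hn₁, hn₂, by rw [real_inner_comm]; exact h13, by rw [real_inner_comm]; exact h23, h12⟩
  have hwn : ⟪S w, n⟫_ℝ = Real.sqrt (2 / 3) := by
    rcases huniq w hw hpos with rfl | rfl | rfl
    · exact hn₁
    · exact hn₂
    · exact hn₃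
  have hh' : w - u' ∈ fccSlots := sub_mem_fccSlots_of_inner_eq_half hw hu' hwu'
  have hh'' : w - u'' ∈ fccSlots := sub_mem_fccSlots_of_inner_eq_half hw hu'' hwu''
  have hh'n : ⟪S (w - u'), n⟫_ℝ = 0 := by rw [map_sub, inner_sub_left, hwn, hn']; ring
  have hh''n : ⟪S (w - u''), n⟫_ℝ = 0 := by rw [map_sub, inner_sub_left, hwn, hn'']; ring
  have hE' : p + S (w - u') ∈ D := hplaneD _ hh' hh'n
  have hE'' : p + S (w - u'') ∈ D := hplaneD _ hh'' hh''n
  set R := (ℝ ∙ n)ᗮ.reflection with hR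
  have hx : S w - (2 * ⟪S w, n⟫_ℝ) • n = R (S w) := (reflection_unit_apply hn1 (S w)).symm
  have hRfix : ∀ {v : EuclideanSpace ℝ (Fin 3)}, ⟪S v, n⟫_ℝ = 0 → R (S v) = S v := fun hv =>
    Submodule.reflection_mem_subspace_eq_self (Submodule.mem_orthogonal_singleton_iff_inner_left.2 hv)
  have nw : ‖S w‖ = 1 := by rw [LinearIsometryEquiv.norm_map]; exact norm_eq_one_of_mem_fccSlots hw
  have d0 : dist (p + R (S w)) p = 1 := by rw [dist_eq_norm, add_sub_cancel_left, LinearIsometryEquiv.norm_map, nw]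
  have dside : ∀ {u : EuclideanSpace ℝ (Fin 3)}, u ∈ fccSlots → ⟪S (w - u), n⟫_ℝ = 0 → dist (p + R (S w)) (p + S (w - u)) = 1 := by
    intro u hu hun
    rw [dist_eq_norm, add_sub_add_left_eq_sub, ← hRfix hun, ← map_sub, LinearIsometryEquiv.norm_map, ← map_sub, LinearIsometryEquiv.norm_map,
      sub_sub_cancel]
    exact norm_eq_one_of_mem_fccSlots hu
  have d12 : dist (p + S (w - u')) (p + S (w - u'')) = 1 := by
    rw [dist_eq_norm, add_sub_add_left_eq_sub, ← map_sub, LinearIsometryEquiv.norm_map, show w - u' - (w - u'') = u'' - u' by abel]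
    exact norm_sub_eq_one_of_inner_half (norm_eq_one_of_mem_fccSlots hu'') (norm_eq_one_of_mem_fccSlots hu') (by rw [real_inner_comm]; exact hu'u'')
  have hcap : CapsTriangleIn D (p + R (S w)) :=
    ⟨p, hpD, _, hE', _, hE'', dist_slotSite_eq_one S p hh', dist_slotSite_eq_one S p hh'', d12, d0, dside hu' hh'n, dside hu'' hh''n⟩
  rw [hx] at hmem ⊢
  refine hD.2 _ hmem ?_ hcap
  have : dist z (p + R (S w)) ≤ dist z p + dist p (p + R (S w)) := dist_triangle _ _ _
  rw [dist_comm p, d0] at this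
  linarith

/-- **Reflected positions of a menu normal cap triangles of any cap-closed core** (any slot; in-plane slots reflect to themselves). -/
theorem reflect_slot_mem_of_capClosed {X D : Finset (EuclideanSpace ℝ (Fin 3))} {z : EuclideanSpace ℝ (Fin 3)} (hD : IsCapClosed X z D)
    {S : EuclideanSpace ℝ (Fin 3) ≃ₗᵢ[ℝ] EuclideanSpace ℝ (Fin 3)} {n p : EuclideanSpace ℝ (Fin 3)} (hpD : p ∈ D) (hzp : dist z p ≤ 2) (hn : IsMenuNormal S n)
    (hplaneD : ∀ u ∈ fccSlots, ⟪S u, n⟫_ℝ = 0 → p + S u ∈ D) {w : EuclideanSpace ℝ (Fin 3)} (hw : w ∈ fccSlots)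
    (hmem : p + (S w - (2 * ⟪S w, n⟫_ℝ) • n) ∈ X) : p + (S w - (2 * ⟪S w, n⟫_ℝ) • n) ∈ D := by
  obtain ⟨hn1, hmenu⟩ := hn
  rcases lt_trichotomy 0 ⟪S w, n⟫_ℝ with hpos | hzero | hneg
  · exact reflect_far_slot_mem_of_capClosed hD hpD hzp hn1 hmenu hplaneD hw hpos hmem
  · have e : S w - (2 * ⟪S w, n⟫_ℝ) • n = S w := by rw [← hzero]; simp
    rw [e]
    exact hplaneD w hw hzero.symm
  · have hmenu' : ∀ u ∈ fccSlots, ⟪S u, -n⟫_ℝ = 0 ∨ ⟪S u, -n⟫_ℝ = Real.sqrt (2 / 3) ∨ ⟪S u, -n⟫_ℝ = -Real.sqrt (2 / 3) := by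
      intro u hu
      rcases hmenu u hu with h | h | h
      · exact Or.inl (by rw [inner_neg_right, h, neg_zero])
      · exact Or.inr (Or.inr (by rw [inner_neg_right, h]))
      · exact Or.inr (Or.inl (by rw [inner_neg_right, h, neg_neg]))
    have hplane' : ∀ u ∈ fccSlots, ⟪S u, -n⟫_ℝ = 0 → p + S u ∈ D := fun u hu h => hplaneD u hu (by rw [inner_neg_right] at h; linarith)
    have e : S w - (2 * ⟪S w, n⟫_ℝ) • n = S w - (2 * ⟪S w, -n⟫_ℝ) • (-n) := by rw [inner_neg_right]; simp [smul_neg, neg_smul]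
    rw [e] at hmem ⊢
    exact reflect_far_slot_mem_of_capClosed hD hpD hzp (by rw [norm_neg, hn1]) hmenu' hplane' hw (by rw [inner_neg_right]; linarith) hmem

/-! ### Every (A)-pair near the payer descends to a piece -/

section Descent

variable {Y : Finset (EuclideanSpace ℝ (Fin 3))} (hY : ∀ p ∈ Y, ∀ p' ∈ Y, p ≠ p' → 1 ≤ dist p p') {v : WordVersion} {S₁ S₂ : PlateSystem}
  (h₁ : S₁.RT ⊆ fccSlots) (h₂ : S₂.RT ⊆ fccSlots) {z : EuclideanSpace ℝ (Fin 3)}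
  {G : EuclideanSpace ℝ (Fin 3) ≃ₗᵢ[ℝ] EuclideanSpace ℝ (Fin 3)} {q b d : EuclideanSpace ℝ (Fin 3)}

include hY h₁ h₂ in
/-- **A STRAIGHT-MOVE (A)-pair ending within `1` of the payer is an (A)-pair of the reader's piece `pieceOf Y z q G`.** -/
theorem isEndPairA_pieceOf_of_straight (hzb : dist z b ≤ 1) (hq : q ∈ Y) (hb : b ∈ Y) (hpay : HasTwoPayers Y b) (hadm : S₁.Adm G d ∨ S₂.Adm G d) (hqd : q - d ∈ Y)
    (hrd : IsFull Y G q ∨ (v = WordVersion.v2 ∧ IsNarrow Y G d q) ∨ ∃ m, IsTwinReading Y G m q ∧ ⟪d, m⟫_ℝ = 0) (hbq : b = q + d) (hnm : ¬ IsMoving Y v G d b) :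
    IsEndPairA (pieceOf Y z q G) v S₁ S₂ b q := by
  classical
  set E := pieceOf Y z q G with hE
  have hEY : E ⊆ Y := pieceOf_subset Y z q G
  have hD : IsCapClosed Y z E := isCapClosed_pieceOf Y z q G
  obtain ⟨⟨u, hu, hdu⟩, ⟨u', hu', hdu'⟩⟩ : (∃ u ∈ fccSlots, d = G u) ∧ (∃ u ∈ fccSlots, -d = G u) := by
    rcases hadm with h | h
    · exact exists_slots_of_adm h₁ h
    · exact exists_slots_of_adm h₂ h
  have hdqb : dist q b = 1 := by rw [hbq, hdu]; exact dist_slotSite_eq_one G q hu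
  have hzq : dist z q ≤ 2 := by linarith [dist_triangle z b q, dist_comm q b]
  have hq0 : G.symm (q - q) ∈ coaxialModule 1 (Real.sqrt (2 / 3)) := by rw [sub_self, map_zero]; exact ⟨0, 0, 0, 0, by simp⟩
  have hqE : q ∈ E := mem_pieceOf_base G hq (by linarith)
  -- site positions around `q` and `b`
  have hsq : ∀ w ∈ fccSlots, q + G w ∈ Y → q + G w ∈ E := fun w hw hmem =>
    mem_pieceOf_of_slot_at G hq0 hw hmem (by linarith [dist_triangle z q (q + G w), dist_slotSite_eq_one G q hw])
  have hbE : b ∈ E := by rw [hbq, hdu] at hb ⊢; exact hsq u hu hb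
  have hbmod : G.symm (b - q) ∈ coaxialModule 1 (Real.sqrt (2 / 3)) := by
    rw [hbq, hdu, add_sub_cancel_left, LinearIsometryEquiv.symm_apply_apply]; exact slot_mem_module hu
  have hsb : ∀ w ∈ fccSlots, b + G w ∈ Y → b + G w ∈ E := fun w hw hmem =>
    mem_pieceOf_of_slot_at G hbmod hw hmem (by linarith [dist_triangle z b (b + G w), dist_slotSite_eq_one G b hw])
  have hmq : ∀ m, IsTwinReading Y G m q → ∀ w ∈ fccSlots, q + (G w - (2 * ⟪G w, m⟫_ℝ) • m) ∈ Y → q + (G w - (2 * ⟪G w, m⟫_ℝ) • m) ∈ E :=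
    fun m htw w hw hmem => reflect_slot_mem_of_capClosed hD hqE hzq htw.1 (fun u hu h0 => hsq u hu (htw.2.1 u hu h0.le)) hw hmem
  have hqdE : q - d ∈ E := by rw [sub_eq_add_neg, hdu'] at hqd ⊢; exact hsq u' hu' hqd
  exact ⟨hqE, hbE, hasTwoPayers_of_subset hY hEY hpay, G, d, hadm, hqdE, isEndMove_straight_of_sites hEY hrd hbq hnm hbE hsq hsb hmq⟩

include hY h₁ h₂ in
/-- **A CROSS-MOVE (A)-pair ending within `1` of the payer is an (A)-pair of the target's twin piece `pieceOf Y z b (G.trans R_m)`.** -/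
theorem isEndPairA_pieceOf_of_cross {m : EuclideanSpace ℝ (Fin 3)} (hzb : dist z b ≤ 1) (hq : q ∈ Y) (hb : b ∈ Y) (hpay : HasTwoPayers Y b)
    (hadm : S₁.Adm G d ∨ S₂.Adm G d) (hqd : q - d ∈ Y) (htw : IsTwinReading Y G m q) (hdm : ⟪d, m⟫_ℝ = Real.sqrt (2 / 3))
    (hbq : b = q - (d - (2 * ⟪d, m⟫_ℝ) • m)) (hnm : ¬ IsMoving Y v (G.trans (ℝ ∙ m)ᗮ.reflection) (b - q) b) :
    IsEndPairA (pieceOf Y z b (G.trans (ℝ ∙ m)ᗮ.reflection)) v S₁ S₂ b q := by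
  classical
  set R := (ℝ ∙ m)ᗮ.reflection with hR
  set G' := G.trans R with hG'
  set E := pieceOf Y z b G' with hE
  have hEY : E ⊆ Y := pieceOf_subset Y z b G'
  have hD : IsCapClosed Y z E := isCapClosed_pieceOf Y z b G'
  have hm1 : ‖m‖ = 1 := htw.1.1
  have hG'app : ∀ w, G' w = R (G w) := fun w => rfl
  have hRG' : ∀ w, R (G' w) = G w := fun w => by rw [hG'app, Submodule.reflection_reflection]
  have hRapp : ∀ x : EuclideanSpace ℝ (Fin 3), R x = x - (2 * ⟪x, m⟫_ℝ) • m := fun x => reflection_unit_apply hm1 x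
  have hinn : ∀ w, ⟪G' w, m⟫_ℝ = -⟪G w, m⟫_ℝ := by
    intro w
    rw [hG'app, hRapp, inner_sub_left, inner_smul_left, real_inner_self_eq_norm_sq, hm1]
    simp; ring
  have hn' : IsMenuNormal G' m := by
    refine ⟨hm1, fun w hw => ?_⟩
    rcases htw.1.2 w hw with h | h | h
    · exact Or.inl (by rw [hinn, h, neg_zero])
    · exact Or.inr (Or.inr (by rw [hinn, h]))
    · exact Or.inr (Or.inl (by rw [hinn, h, neg_neg]))
  obtain ⟨⟨u, hu, hdu⟩, ⟨u', hu', hdu'⟩⟩ : (∃ u ∈ fccSlots, d = G u) ∧ (∃ u ∈ fccSlots, -d = G u) := by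
    rcases hadm with h | h
    · exact exists_slots_of_adm h₁ h
    · exact exists_slots_of_adm h₂ h
  have hqb : q = b + G' u := by rw [hbq, hG'app, hRapp, ← hdu]; abel
  have hdbq : dist b q = 1 := by rw [hqb]; exact dist_slotSite_eq_one G' b hu
  have hzq : dist z q ≤ 2 := by linarith [dist_triangle z b q]
  have hb0 : G'.symm (b - b) ∈ coaxialModule 1 (Real.sqrt (2 / 3)) := by rw [sub_self, map_zero]; exact ⟨0, 0, 0, 0, by simp⟩
  have hqmod : G'.symm (q - b) ∈ coaxialModule 1 (Real.sqrt (2 / 3)) := by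
    rw [hqb, add_sub_cancel_left, LinearIsometryEquiv.symm_apply_apply]; exact slot_mem_module hu
  have hbE : b ∈ E := mem_pieceOf_base G' hb (by linarith)
  have hqE : q ∈ E := by rw [hqb] at hq ⊢; exact mem_pieceOf_of_slot_at G' hb0 hu hq (by rw [← hqb]; linarith)
  -- `q`'s in-plane hexagon (sites) is occupied by the twin reading
  have hplane : ∀ w ∈ fccSlots, ⟪G' w, m⟫_ℝ = 0 → q + G' w ∈ E := by
    intro w hw h0
    have hG0 : ⟪G w, m⟫_ℝ = 0 := by rw [hinn] at h0; linarith
    have e : G' w = G w := by rw [hG'app]; exact Submodule.reflection_mem_subspace_eq_self (Submodule.mem_orthogonal_singleton_iff_inner_left.2 hG0)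
    have hmem : q + G w ∈ Y := htw.2.1 w hw hG0.le
    have hmem' : q + G' w ∈ Y := by rw [e]; exact hmem
    exact mem_pieceOf_of_slot_at G' hqmod hw hmem' (by linarith [dist_triangle z q (q + G' w), dist_slotSite_eq_one G' q hw])
  -- `q`'s `G`-dozen positions are reflected `G'`-positions at `q`
  have hsq : ∀ w ∈ fccSlots, q + G w ∈ Y → q + G w ∈ E := by
    intro w hw hmem
    have e : q + G w = q + (G' w - (2 * ⟪G' w, m⟫_ℝ) • m) := by rw [← hRapp, hRG']
    rw [e] at hmem ⊢
    exact reflect_slot_mem_of_capClosed hD hqE hzq hn' hplane hw hmem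
  -- `q`'s reflected positions are `G'`-sites
  have hmq : ∀ w ∈ fccSlots, q + (G w - (2 * ⟪G w, m⟫_ℝ) • m) ∈ Y → q + (G w - (2 * ⟪G w, m⟫_ℝ) • m) ∈ E := by
    intro w hw hmem
    have e : q + (G w - (2 * ⟪G w, m⟫_ℝ) • m) = q + G' w := by rw [← hRapp, ← hG'app]
    rw [e] at hmem ⊢
    exact mem_pieceOf_of_slot_at G' hqmod hw hmem (by linarith [dist_triangle z q (q + G' w), dist_slotSite_eq_one G' q hw])
  -- `b`'s `G'`-dozen positions are sites
  have hsb' : ∀ w ∈ fccSlots, b + G' w ∈ Y → b + G' w ∈ E := fun w hw hmem =>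
    mem_pieceOf_of_slot_at G' hb0 hw hmem (by linarith [dist_triangle z b (b + G' w), dist_slotSite_eq_one G' b hw])
  have hqdE : q - d ∈ E := by
    have e : q - d = q + G u' := by rw [sub_eq_add_neg, hdu']
    rw [e] at hqd ⊢
    exact hsq u' hu' hqd
  exact ⟨hqE, hbE, hasTwoPayers_of_subset hY hEY hpay, G, d, hadm, hqdE, isEndMove_cross_of_sites hEY htw hdm hbq hnm hsq hmq hsb'⟩

include hY h₁ h₂ in
/-- **EVERY (A)-END PAIR NEAR THE PAYER DESCENDS TO A PIECE**: for `(b, q)` an (A)-end pair of `Y` with `b` within `1` of `z` there are an origin `c ∈ {q, b}` and a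
placement `S` with `(b, q)` an (A)-end pair of `pieceOf Y z c S`. -/
theorem exists_pieceOf_of_isEndPairA (hzb : dist z b ≤ 1) (hp : IsEndPairA Y v S₁ S₂ b q) :
    ∃ c : EuclideanSpace ℝ (Fin 3), ∃ S : EuclideanSpace ℝ (Fin 3) ≃ₗᵢ[ℝ] EuclideanSpace ℝ (Fin 3), (c = q ∨ c = b) ∧ IsEndPairA (pieceOf Y z c S) v S₁ S₂ b q := by
  obtain ⟨hq, hb, hpay, G, d, hadm, hqd, hmove⟩ := hp
  rcases hmove with ⟨hrd, hbq, hnm⟩ | ⟨m, htw, hdm, hbq, hnm⟩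
  · exact ⟨q, G, Or.inl rfl, isEndPairA_pieceOf_of_straight hY h₁ h₂ hzb hq hb hpay hadm hqd hrd hbq hnm⟩
  · exact ⟨b, G.trans (ℝ ∙ m)ᗮ.reflection, Or.inr rfl, isEndPairA_pieceOf_of_cross hY h₁ h₂ hzb hq hb hpay hadm hqd htw hdm hbq hnm⟩

end Descent

end TailResidue

end Summit.Ventures.Crystal3D.Theorems

end
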